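import Literature.AlgebraicGeometry.Motives.WeilDatumHodgeStructure
import Literature.LinearAlgebra.Alternating.CompatibleComplexStructure
import HarnessLib

/-!
# The type-II sub-domain of the Weil period domain: complex structures commuting with a quaternionic `j`

Family `hodge`, layer `Literature/AlgebraicGeometry/Motives`; THEOREMS ONLY (no definition, no named fact, no `sorry`;
D-0026). Sequel to `Motives/WeilDiscriminantTypeII`, `…TypeIIModel`, `…/WeilTypeIIOperatorOfDiscriminant` (the
ARITHMETIC of a type-II structure on a rational Weil datum: a `ℚ`-linear, `K`-ANTILINEAR `j` with `j² = b` which is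
ROSATI-SYMMETRIC for `E`, `D = K ⊕ Kj = (-d, b)_ℚ` — [vanGeemenVerra2003QuaternionicPryms] Lemma 4.5 (proof): "`F = K ⊕ Kj`,
`xj = j x̄`"; for `b > 0` the algebra `D` is INDEFINITE, Albert type II [Shimura1963AnalyticFamilies, §4]) and to
`Motives/WeilDatumPeriodDomain`, `Motives/WeilDatumHodgeStructure` (the period domain `X⁺(D) = {J | IsWeilComplexStructure
D.hForm J}` of a Weil datum `D = (V, α, E)`, van Geemen 5.5–5.8 / Deligne's `X⁺`, and the `ℚ`-Hodge structure
`D.hodgeStructure J` of each of its points). This file is the PERIOD-DOMAIN half of the type-II story: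

**the complex structures of Weil type that COMMUTE with `j` — the type-II sub-domain `𝔖(j) ⊂ X⁺(D)` — exist (for `b > 0`),
and at every `J ∈ 𝔖(j)` the operator `j` is an endomorphism of the rational Hodge structure of `J`.**

This is the sentence "on the model `⊕ᵢ (K ⊕ Kj)` … the complex structures `J` with `JV₊ = V₊`, `jV₊ = V₋` commute with `j`,
and these `J` form the type-II sub-domain `𝔖ₙ` (a Siegel space of genus `n`, `dim = n(n+1)/2`) of van Geemen's `Hₙ`
(`dim = n²`)" of the route memos (vhodge ROUTE-P3-g17 §3), in the tree's vocabulary; van Geemen 5.7: "since the complex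
structure `J` commutes with the action of `K`, we have `K ⊂ End(X)_ℚ`" — the same mechanism applied to `j` makes
`D = K ⊕ Kj` act on the Hodge structure, which is the input format of Riemann's theorem
(`HodgeTheory/AbelianVarietyHodgeHomFullnessHolds.exists_hom_map_eq_nsmul_of_oneZero`) and of clause (5U) of Deligne's
period construction (`HodgeTheory/WeilFamilyPeriodConstructionAtWeilType`).

## What is proved (0 sorry)

* §1 REAL MODEL (`exists_complexStructure_comm_of_anticomm`). On a finite-dimensional real `W` with a complex structure
  `I` (`I² = -1`), a non-degenerate alternating `E` with `E(Ix, Iy) = E(x, y)`, and `T` with `TI = -IT`, `T² = β²`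
  (`β > 0`), `E(Tx, y) = E(x, Ty)`: there is `J` with `JI = IJ`, `J² = -1`, `E(Jx, Jy) = E(x, y)`, `E(x, Jx) > 0`
  (`x ≠ 0`) AND `TJ = JT`. Mechanism (the Siegel space inside the type AIII domain): `W = W₊ ⊕ W₋`, `W_± = ker(T ∓ β)`,
  `I W₊ = W₋`, `E(W₊, W₋) = 0` (`β E(x,y) = E(Tx,y) = E(x,Ty) = -β E(x,y)`), so `E|_{W₊}` is a real symplectic form; a
  compatible complex structure `J₀` on `(W₊, E)` (`LinearAlgebra/Alternating/CompatibleComplexStructure`, McDuff–Salamon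
  Prop. 2.5.4) extended `I`-linearly, `J(x + Iy) = J₀x + IJ₀y`, does it; conversely every such `J` arises this way, so
  `𝔖(j) ≅ 𝒥(W₊, E|) =` the Siegel space of genus `½ dim W₊` (the converse is not formalized here).
* §2 THE WEIL DATUM. For `D : WeilDatum V` and `j : V →ₗ[ℚ] V` with `j α = -α j`, `j² = b`, `E(jx, y) = E(x, jy)`:
  `j_ℝ` anticommutes with `I₀ = √-d ⊗ 1/√d` (`baseChange_I₀_of_anticomm`: `j_ℝ` is `ℂ`-ANTILINEAR on `(V_ℝ, i)`,
  `toCx_baseChange_smul`), `E_ℝ(j_ℝ x, j_ℝ y) = b E_ℝ(x, y)`, and **`H(jx, jy) = -b · conj H(x, y)`**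
  (`hForm_typeII`) — the Hermitian-form signature of a type-II operator used in `Motives/WeilDiscriminantTypeII`.
* §3 **`exists_isWeilComplexStructure_comm_typeII`**: for `b > 0` there is `J ∈ X⁺(D)` (`IsWeilComplexStructure D.hForm J`)
  whose realification commutes with `j_ℝ` — THE TYPE-II SUB-DOMAIN IS NON-EMPTY; and for every such `J`,
  **`baseChange_mem_piece_one_zero_of_comm`**: `j_ℂ (V^{1,0}_J) ⊆ V^{1,0}_J`, `map_F_hodgeStructure_le_of_comm`:
  `j_ℂ F^p ⊆ F^p` — `j` is an endomorphism of the weight-one `ℚ`-Hodge structure `D.hodgeStructure J` (van Geemen 5.7),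
  packaged as `exists_typeII_weilComplexStructure`. At an eigen-`J` vector, `J(jx) = -i·jx` (`apply_typeII_of_apply_eq_I_smul`:
  `j` swaps `V₊ = ker(J - i)` and `V₋ = ker(J + i)`, the "`jV₊ = V₋`" of the memo).

HONEST REMARKS. Nothing here is about abelian varieties: the passage from "`j` is a Hodge endomorphism of the fibre over
`J`" to "`j = k⁻¹ψ^*` for an endomorphism `ψ` of the fibre `Y_s`" is Riemann's theorem plus a period map (J1 clause (5U)),
both elsewhere in the tree; Rosati POSITIVITY (`b > 0` is forced for an endomorphism) is not discussed; the identification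
of `𝔖(j)` with a Siegel space and its dimension are not formalized.

## References

* [vanGeemen1994HodgeAV] B. van Geemen, LNM 1594 (1994), 5.5–5.8 (the complex structures `J_{V₊}`, "J commutes with the
  action of `K` ⟹ `K ⊂ End(X)_ℚ`", `Hₙ`), 5.11 (`Hₙ ↪` Siegel space).
* [Shimura1963AnalyticFamilies] G. Shimura, Ann. of Math. 78 (1963), §2 and §4 (Type II: indefinite quaternion algebras,
  the attached bounded symmetric domains are Siegel spaces).
* [vanGeemenVerra2003QuaternionicPryms] B. van Geemen, A. Verra, Topology 42 (2003), Lemma 4.5 (proof): `F = K ⊕ Kj`.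
* [McDuffSalamon2017] D. McDuff, D. Salamon, *Introduction to Symplectic Topology*, 3rd ed., §2.5 Prop. 2.5.4, Lemma 2.5.5.
* [Deligne1982HodgeCycles] P. Deligne, LNM 900, proof of Thm. 4.8, p. 47 (a'), (b') (Deligne's `X⁺`).
-/

noncomputable section

open Module
open scoped TensorProduct ComplexConjugate

namespace Literature.AlgebraicGeometry.Motives

universe u

/-! ## §1 The real model: a compatible complex structure commuting with an anti-commuting `T`, `T² = β² > 0` -/

section RealModel

variable {W : Type*} [AddCommGroup W] [Module ℝ W]

/-- `E(x, y) = 0` for `x ∈ ker(T - β)`, `y ∈ ker(T + β)` when `T` is `E`-symmetric and `β ≠ 0`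
(`β E(x, y) = E(Tx, y) = E(x, Ty) = -β E(x, y)`): the two eigenspaces of a type-II operator are `E`-orthogonal.
[cite: vanGeemen1994HodgeAV, 5.5–5.6] -/
theorem apply_eq_zero_of_eigen_of_eigen_neg (E : LinearMap.BilinForm ℝ W) (T : W →ₗ[ℝ] W) {β : ℝ} (hβ : β ≠ 0)
    (hET : ∀ x y, E (T x) y = E x (T y)) {x y : W} (hx : T x = β • x) (hy : T y = -(β • y)) : E x y = 0 := by
  have h := hET x y
  rw [hx, hy] at h
  simp only [map_smul, LinearMap.smul_apply, map_neg, smul_eq_mul] at h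
  have h2 : 2 * β * E x y = 0 := by linarith
  rcases mul_eq_zero.1 h2 with h | h
  · exact absurd h (mul_ne_zero two_ne_zero hβ)
  · exact h

/-- **The real model of the type-II sub-domain is non-empty.** Let `W` be a finite-dimensional real vector space with
`I² = -1`, `E` non-degenerate alternating with `E(Ix, Iy) = E(x, y)`, and `T` with `TI = -IT`, `T² = β²` (`β > 0`),
`E(Tx, y) = E(x, Ty)`. Then there is `J` commuting with `I` AND with `T`, `J² = -1`, satisfying the Riemann relations
`E(Jx, Jy) = E(x, y)`, `E(x, Jx) > 0` (`x ≠ 0`). Construction: `W₊ = ker(T - β)` is a real form of `(W, I)`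
(`W = W₊ ⊕ IW₊`), `E(W₊, IW₊) = 0`, `E|_{W₊}` is symplectic; take a compatible `J₀` on `(W₊, E|)` (McDuff–Salamon Prop. 2.5.4)
and `J(x + Iy) = J₀x + IJ₀y`. These `J` are the points of the Siegel space of `(W₊, E|)` inside the domain of all
`I`-linear `E`-compatible complex structures. [cite: vanGeemen1994HodgeAV, 5.5–5.7]
[cite: McDuffSalamon2017, §2.5 Prop. 2.5.4 and Lemma 2.5.5] [cite: Shimura1963AnalyticFamilies, §2 (Type II)] -/
theorem exists_complexStructure_comm_of_anticomm [FiniteDimensional ℝ W] (E : LinearMap.BilinForm ℝ W)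
    (I T : W →ₗ[ℝ] W) {β : ℝ} (hE : ∀ x y, E y x = -E x y) (hEI : ∀ x y, E (I x) (I y) = E x y)
    (hI : ∀ x, I (I x) = -x) (hTI : ∀ x, T (I x) = -(I (T x))) (hTT : ∀ x, T (T x) = (β * β) • x)
    (hET : ∀ x y, E (T x) y = E x (T y)) (hβ : 0 < β) (hEnd : E.Nondegenerate) :
    ∃ J : W →ₗ[ℝ] W, (∀ x, J (I x) = I (J x)) ∧ (∀ x, J (J x) = -x) ∧ (∀ x y, E (J x) (J y) = E x y) ∧
      (∀ x, x ≠ 0 → 0 < E x (J x)) ∧ ∀ x, T (J x) = J (T x) := by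
  classical
  have hβ0 : β ≠ 0 := hβ.ne'
  have h2β : 2 * β ≠ 0 := mul_ne_zero two_ne_zero hβ0
  -- the eigenspace `W₊ = ker(T - β)` and the two projections `π` (onto `W₊`) and `ρ` (onto `W₋`)
  let Vp : Submodule ℝ W := LinearMap.ker (T - β • LinearMap.id)
  have memVp : ∀ x, x ∈ Vp ↔ T x = β • x := fun x => by
    simp only [Vp, LinearMap.mem_ker, LinearMap.sub_apply, LinearMap.smul_apply, LinearMap.id_apply, sub_eq_zero]
  let π : W →ₗ[ℝ] W := (2 * β)⁻¹ • (β • LinearMap.id + T)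
  let ρ : W →ₗ[ℝ] W := (2 * β)⁻¹ • (β • LinearMap.id - T)
  have π_apply : ∀ z, π z = (2 * β)⁻¹ • (β • z + T z) := fun z => rfl
  have ρ_apply : ∀ z, ρ z = (2 * β)⁻¹ • (β • z - T z) := fun z => rfl
  have π_add_ρ : ∀ z, π z + ρ z = z := fun z => by
    rw [π_apply, ρ_apply, ← smul_add, show β • z + T z + (β • z - T z) = (2 * β) • z by module, smul_smul,
      inv_mul_cancel₀ h2β, one_smul]
  have Tπ : ∀ z, T (π z) = β • π z := fun z => by
    rw [π_apply, map_smul, map_add, map_smul, hTT]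
    module
  have Tρ : ∀ z, T (ρ z) = -(β • ρ z) := fun z => by
    rw [ρ_apply, map_smul, map_sub, map_smul, hTT]
    module
  have π_mem : ∀ z, π z ∈ Vp := fun z => (memVp _).2 (Tπ z)
  have Iρ_mem : ∀ z, I (ρ z) ∈ Vp := fun z => (memVp _).2 (by rw [hTI, Tρ, map_neg, neg_neg, map_smul])
  have π_of_mem : ∀ x ∈ Vp, π x = x := fun x hx => by
    rw [π_apply, (memVp x).1 hx, show β • x + β • x = (2 * β) • x by module, smul_smul, inv_mul_cancel₀ h2β,
      one_smul]
  have ρ_of_mem : ∀ x ∈ Vp, ρ x = 0 := fun x hx => by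
    rw [ρ_apply, (memVp x).1 hx, sub_self, smul_zero]
  have TI_of_mem : ∀ x ∈ Vp, T (I x) = -(β • I x) := fun x hx => by
    rw [hTI, (memVp x).1 hx, map_smul]
  have π_I_of_mem : ∀ x ∈ Vp, π (I x) = 0 := fun x hx => by
    rw [π_apply, TI_of_mem x hx, add_neg_cancel, smul_zero]
  have ρ_I_of_mem : ∀ x ∈ Vp, ρ (I x) = I x := fun x hx => by
    have h := π_add_ρ (I x)
    rwa [π_I_of_mem x hx, zero_add] at h
  -- `W₊ ⊥ W₋`: `E(x, Iy) = 0 = E(Ix, y)` for `x, y ∈ W₊`, and `E(x, ρ z) = 0`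
  have orthI : ∀ x ∈ Vp, ∀ y ∈ Vp, E x (I y) = 0 := fun x hx y hy =>
    apply_eq_zero_of_eigen_of_eigen_neg E T hβ0 hET ((memVp x).1 hx) (TI_of_mem y hy)
  have orthI' : ∀ x ∈ Vp, ∀ y ∈ Vp, E (I x) y = 0 := fun x hx y hy => by
    rw [hE, orthI y hy x hx, neg_zero]
  have orthρ : ∀ x ∈ Vp, ∀ z, E x (ρ z) = 0 := fun x hx z =>
    apply_eq_zero_of_eigen_of_eigen_neg E T hβ0 hET ((memVp x).1 hx) (Tρ z)
  -- `E|_{W₊}` is alternating and non-degenerate: a real symplectic space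
  have restr : ∀ x y : Vp, (E.restrict Vp) x y = E (x : W) y := fun _ _ => rfl
  have hBa : (E.restrict Vp).IsAlt := fun x => by
    rw [restr]
    have h := hE (x : W) x
    linarith
  have hBnd : (E.restrict Vp).Nondegenerate := by
    refine (hBa.isRefl.nondegenerate_iff_separatingLeft).2 ?_
    intro x hx
    refine Subtype.ext (hEnd.1 (x : W) fun z => ?_)
    have h1 : E (x : W) (π z) = 0 := by
      have := hx ⟨π z, π_mem z⟩
      rwa [restr] at this
    rw [← π_add_ρ z, map_add, h1, orthρ x x.2 z, add_zero]
  -- a compatible complex structure on `(W₊, E|)`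
  obtain ⟨J₀, hJ0sq, hJ0c, hJ0p⟩ :=
    Literature.LinearAlgebra.Alternating.exists_compatibleComplexStructure hBa hBnd
  have hJ0c' : ∀ x y : Vp, E (J₀ x : W) (J₀ y) = E x y := fun x y => by
    have := hJ0c x y
    rwa [restr, restr] at this
  have hJ0p' : ∀ x : Vp, 0 ≤ E (x : W) (J₀ x) := fun x => by
    by_cases hx : x = 0
    · simp [hx]
    · have := hJ0p x hx
      rw [restr] at this
      exact this.le
  -- the `I`-linear extension `J z = J₀ z₊ - I J₀ (I z₋)`
  let P : W →ₗ[ℝ] Vp := LinearMap.codRestrict Vp π π_mem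
  let Q : W →ₗ[ℝ] Vp := LinearMap.codRestrict Vp (I ∘ₗ ρ) Iρ_mem
  have P_val : ∀ z, (P z : W) = π z := fun _ => rfl
  have Q_val : ∀ z, (Q z : W) = I (ρ z) := fun _ => rfl
  let J : W →ₗ[ℝ] W := Vp.subtype ∘ₗ J₀ ∘ₗ P - I ∘ₗ Vp.subtype ∘ₗ J₀ ∘ₗ Q
  have J_apply : ∀ z, J z = (J₀ (P z) : W) - I (J₀ (Q z)) := fun _ => rfl
  have decomp : ∀ z, (P z : W) - I (Q z) = z := fun z => by
    rw [P_val, Q_val, hI, sub_neg_eq_add, π_add_ρ]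
  have P_of_mem : ∀ x : Vp, P (x : W) = x := fun x => Subtype.ext (π_of_mem x x.2)
  have P_I_of_mem : ∀ x : Vp, P (I x) = 0 := fun x => Subtype.ext (π_I_of_mem x x.2)
  have Q_of_mem : ∀ x : Vp, Q (x : W) = 0 := fun x =>
    Subtype.ext (by rw [Q_val, ρ_of_mem x x.2, map_zero, Submodule.coe_zero])
  have Q_I_of_mem : ∀ x : Vp, Q (I x) = -x := fun x =>
    Subtype.ext (by rw [Q_val, ρ_I_of_mem x x.2, hI, Submodule.coe_neg])
  have P_J : ∀ z, P (J z) = J₀ (P z) := fun z => by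
    rw [J_apply, map_sub, P_of_mem, P_I_of_mem, sub_zero]
  have Q_J : ∀ z, Q (J z) = J₀ (Q z) := fun z => by
    rw [J_apply, map_sub, Q_of_mem, Q_I_of_mem, zero_sub, neg_neg]
  have P_I : ∀ z, P (I z) = Q z := fun z => Subtype.ext (by
    rw [P_val, Q_val, π_apply, ρ_apply, hTI, map_smul, map_sub, map_smul, sub_eq_add_neg])
  have Q_I : ∀ z, Q (I z) = -P z := fun z => Subtype.ext (by
    rw [Q_val, Submodule.coe_neg, P_val, ρ_apply, π_apply, hTI, sub_neg_eq_add, ← map_smul, ← map_add,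
      ← map_smul, hI])
  have P_T : ∀ z, P (T z) = β • P z := fun z => Subtype.ext (by
    rw [Submodule.coe_smul, P_val, P_val, π_apply, π_apply, hTT]
    module)
  have Q_T : ∀ z, Q (T z) = -(β • Q z) := fun z => Subtype.ext (by
    rw [Submodule.coe_neg, Submodule.coe_smul, Q_val, Q_val, ρ_apply, ρ_apply, hTT,
      show (2 * β)⁻¹ • (β • T z - (β * β) • z) = -(β • ((2 * β)⁻¹ • (β • z - T z))) by module,
      map_neg, map_smul])
  -- the cross-term identity `E(u - Iv, u' - Iv') = E(u, u') + E(v, v')` on `W₊`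
  have cross : ∀ u v u' v' : Vp, E ((u : W) - I v) ((u' : W) - I v') = E (u : W) u' + E (v : W) v' := by
    intro u v u' v'
    simp only [map_sub, LinearMap.sub_apply]
    rw [orthI u u.2 v' v'.2, orthI' v v.2 u' u'.2, hEI, sub_zero, zero_sub, sub_neg_eq_add]
  refine ⟨J, fun z => ?_, fun z => ?_, fun z z' => ?_, fun z hz => ?_, fun z => ?_⟩
  · -- `JI = IJ`
    rw [J_apply, J_apply, P_I, Q_I, map_neg, Submodule.coe_neg, map_neg, sub_neg_eq_add, map_sub, hI, sub_neg_eq_add,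
      add_comm]
  · -- `J² = -1`
    conv_rhs => rw [← decomp z]
    rw [J_apply, P_J, Q_J, hJ0sq, hJ0sq, Submodule.coe_neg, Submodule.coe_neg, map_neg, neg_sub', sub_neg_eq_add]
  · -- `E(Jz, Jz') = E(z, z')`
    conv_rhs => rw [← decomp z, ← decomp z']
    rw [J_apply, J_apply, cross, cross, hJ0c', hJ0c']
  · -- `E(z, Jz) > 0`
    have h := cross (P z) (Q z) (J₀ (P z)) (J₀ (Q z))
    rw [decomp z] at h
    rw [J_apply, h]
    by_cases hP : P z = 0
    · have hQ : Q z ≠ 0 := fun hQ => hz (by rw [← decomp z, hP, hQ, Submodule.coe_zero, map_zero, sub_zero])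
      have := hJ0p (Q z) hQ
      rw [restr] at this
      exact add_pos_of_nonneg_of_pos (hJ0p' _) this
    · have := hJ0p (P z) hP
      rw [restr] at this
      exact add_pos_of_pos_of_nonneg this (hJ0p' _)
  · -- `TJ = JT`
    rw [J_apply, J_apply, map_sub, (memVp _).1 (J₀ (P z)).2, TI_of_mem _ (J₀ (Q z)).2, P_T, Q_T, map_neg, map_smul,
      map_smul, Submodule.coe_neg, Submodule.coe_smul, Submodule.coe_smul, map_neg, map_smul]

end RealModel

section
variable {V : Type u} [AddCommGroup V] [Module ℚ V]

/-- `j_ℝ² = b`. [cite: vanGeemenVerra2003QuaternionicPryms, Lemma 4.5 (proof)] -/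
theorem baseChange_baseChange_of_comp_self (j : V →ₗ[ℚ] V) {b : ℚ} (hjj : ∀ x, j (j x) = b • x)
    (x : ℝ ⊗[ℚ] V) :
    j.baseChange ℝ (j.baseChange ℝ x) = (b : ℝ) • x := by
  induction x using TensorProduct.induction_on with
  | zero => simp
  | tmul a v =>
    rw [LinearMap.baseChange_tmul, LinearMap.baseChange_tmul, hjj, TensorProduct.tmul_smul,
      ← algebraMap_smul ℝ b (a ⊗ₜ[ℚ] v), eq_ratCast]
  | add x y hx hy => rw [map_add, map_add, hx, hy, smul_add]

end

namespace WeilDatum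

variable {V : Type u} [AddCommGroup V] [Module ℚ V] (D : WeilDatum V) (j : V →ₗ[ℚ] V) {b : ℚ}

/-! ## §2 A type-II operator on a Weil datum: realification, antilinearity, `H(jx, jy) = -b·conj H(x, y)` -/

/-- `j_ℝ α_ℝ = -α_ℝ j_ℝ` for a `K`-antilinear `j` (`jα = -αj`).
[cite: vanGeemenVerra2003QuaternionicPryms, Lemma 4.5 (proof)] -/
theorem baseChange_αℝ_of_anticomm (hjα : ∀ x, j (D.α x) = -(D.α (j x))) (x : ℝ ⊗[ℚ] V) :
    j.baseChange ℝ (D.αℝ x) = -(D.αℝ (j.baseChange ℝ x)) := by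
  induction x using TensorProduct.induction_on with
  | zero => simp
  | tmul a v =>
    rw [αℝ_tmul, LinearMap.baseChange_tmul, LinearMap.baseChange_tmul, αℝ_tmul, hjα, TensorProduct.tmul_neg]
  | add x y hx hy => rw [map_add, map_add, hx, hy, map_add, map_add, neg_add]

/-- **`j_ℝ` is `ℂ`-antilinear on `(V_ℝ, i)`**: `j_ℝ I₀ = -I₀ j_ℝ`.
[cite: vanGeemenVerra2003QuaternionicPryms, Lemma 4.5 (proof)]
[cite: vanGeemen1994HodgeAV, 5.5] -/
theorem baseChange_I₀_of_anticomm (hjα : ∀ x, j (D.α x) = -(D.α (j x))) (x : ℝ ⊗[ℚ] V) :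
    j.baseChange ℝ (D.I₀ x) = -(D.I₀ (j.baseChange ℝ x)) := by
  rw [I₀_apply, map_smul, D.baseChange_αℝ_of_anticomm j hjα, I₀_apply, smul_neg]

/-- `E_ℝ(j_ℝ x, y) = E_ℝ(x, j_ℝ y)`: the realification of a Rosati-symmetric `j` is `E_ℝ`-symmetric.
[cite: vanGeemenVerra2003QuaternionicPryms, Lemma 4.5 (proof)] -/
theorem Eℝ_baseChange_left (hjE : ∀ x y, D.E (j x) y = D.E x (j y)) (x y : ℝ ⊗[ℚ] V) :
    D.Eℝ (j.baseChange ℝ x) y = D.Eℝ x (j.baseChange ℝ y) := by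
  induction x using TensorProduct.induction_on generalizing y with
  | zero => simp
  | tmul a v =>
    induction y using TensorProduct.induction_on with
    | zero => simp
    | tmul a' v' => rw [LinearMap.baseChange_tmul, LinearMap.baseChange_tmul, Eℝ_tmul, Eℝ_tmul, hjE]
    | add y₁ y₂ h₁ h₂ => rw [map_add, map_add, map_add, h₁, h₂]
  | add x₁ x₂ h₁ h₂ =>
    rw [map_add, map_add, LinearMap.add_apply, map_add, LinearMap.add_apply, h₁, h₂]

/-- `E_ℝ(j_ℝ x, j_ℝ y) = b E_ℝ(x, y)`: `j_ℝ` is an `E_ℝ`-similitude of multiplier `b = j²`.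
[cite: vanGeemenVerra2003QuaternionicPryms, Lemma 4.5 (proof)] -/
theorem Eℝ_baseChange_baseChange_of_comp_self (hjj : ∀ x, j (j x) = b • x)
    (hjE : ∀ x y, D.E (j x) y = D.E x (j y))
    (x y : ℝ ⊗[ℚ] V) : D.Eℝ (j.baseChange ℝ x) (j.baseChange ℝ y) = (b : ℝ) * D.Eℝ x y := by
  rw [D.Eℝ_baseChange_left j hjE, baseChange_baseChange_of_comp_self j hjj, map_smul, smul_eq_mul]

/-- **Antilinearity on `(V_ℝ, i)`**: `j(z·x) = z̄·j(x)` for `z ∈ ℂ` — a type-II operator is a CONJUGATE-linear map of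
van Geemen's complex vector space `(V_ℝ, i)`. [cite: vanGeemenVerra2003QuaternionicPryms, Lemma 4.5 (proof: "xj = j x̄")]
[cite: vanGeemen1994HodgeAV, 5.5] -/
theorem toCx_baseChange_smul (hjα : ∀ x, j (D.α x) = -(D.α (j x))) (z : ℂ) (x : D.Cx) :
    D.toCx (j.baseChange ℝ (D.ofCx (z • x))) = conj z • D.toCx (j.baseChange ℝ (D.ofCx x)) := by
  rw [ofCx_smul, map_add, map_smul, map_smul, D.baseChange_I₀_of_anticomm j hjα, smul_toCx, Complex.conj_re,
    Complex.conj_im, neg_smul, smul_neg]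

/-- **`H(jx, jy) = -b · conj H(x, y)`** for van Geemen's Hermitian form `H = E(·, i·) + iE` and a Rosati-symmetric
`K`-antilinear `j` with `j² = b`: the operator `j` is a CONJUGATE-SIMILITUDE of `H` of multiplier `-b` (so `H(x, jx) = 0`
and `j`-adapted orthogonal frames have Gram blocks `diag(a, -b a)`, `Motives/WeilDiscriminantTypeII`).
[cite: vanGeemenVerra2003QuaternionicPryms, Lemma 4.5 (proof)] [cite: vanGeemen1994HodgeAV, Lemma 5.2 (2) and 5.6] -/
theorem hForm_typeII (hjα : ∀ x, j (D.α x) = -(D.α (j x))) (hjj : ∀ x, j (j x) = b • x)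
    (hjE : ∀ x y, D.E (j x) y = D.E x (j y)) (x y : D.Cx) :
    D.hForm (D.toCx (j.baseChange ℝ (D.ofCx x))) (D.toCx (j.baseChange ℝ (D.ofCx y))) =
      -(b : ℂ) * conj (D.hForm x y) := by
  have hI : D.I₀ (j.baseChange ℝ (D.ofCx y)) = -(j.baseChange ℝ (D.I₀ (D.ofCx y))) := by
    rw [D.baseChange_I₀_of_anticomm j hjα, neg_neg]
  apply Complex.ext
  · rw [hForm_apply_re, ofCx_toCx, ofCx_toCx, hI, map_neg, D.Eℝ_baseChange_baseChange_of_comp_self j hjj hjE]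
    simp [Complex.mul_re, hForm_apply_re]
  · rw [hForm_apply_im, ofCx_toCx, ofCx_toCx, D.Eℝ_baseChange_baseChange_of_comp_self j hjj hjE]
    simp [Complex.mul_im, hForm_apply_im]

/-! ## §3 The type-II sub-domain of `X⁺(D)` is non-empty; `j` is a Hodge endomorphism on it -/

/-- **THE TYPE-II SUB-DOMAIN IS NON-EMPTY.** For a Weil datum `D = (V, α, E)` and a `ℚ`-linear `K`-ANTILINEAR `j`
(`jα = -αj`) with `j² = b > 0`, ROSATI-SYMMETRIC for `E` (`E(jx, y) = E(x, jy)`; `D = K ⊕ Kj = (-d, b)_ℚ` indefinite,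
type II), there is a complex structure of Weil type `J ∈ X⁺(D)` (`IsWeilComplexStructure D.hForm J`: `ℂ`-linear on
`(V_ℝ, i)`, `J² = -1`, `E(Jx, Jy) = E(x, y)`, `E(x, Jx) > 0`) whose realification COMMUTES with `j_ℝ` — a point of the
type-II sub-domain `𝔖(j) = {J ∈ X⁺(D) : J j_ℝ = j_ℝ J}` (≅ the Siegel space of the real symplectic space
`(ker(j_ℝ - √b), E_ℝ)`, genus `n` if `dim_ℚ V = 4n`). The §1 real model applied to `(V_ℝ, I₀, E_ℝ, j_ℝ, √b)`.
[cite: vanGeemen1994HodgeAV, 5.5–5.8] [cite: Shimura1963AnalyticFamilies, §2 and §4 (Type II)]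
[cite: McDuffSalamon2017, §2.5 Prop. 2.5.4 and Lemma 2.5.5] -/
theorem exists_isWeilComplexStructure_comm_typeII [FiniteDimensional ℚ V] (hjα : ∀ x, j (D.α x) = -(D.α (j x)))
    (hjj : ∀ x, j (j x) = b • x) (hjE : ∀ x y, D.E (j x) y = D.E x (j y)) (hb : 0 < b) :
    ∃ J : D.Cx →ₗ[ℂ] D.Cx, IsWeilComplexStructure D.hForm J ∧
      ∀ a, j.baseChange ℝ (D.realJ J a) = D.realJ J (j.baseChange ℝ a) := by
  have hb' : (0 : ℝ) < b := by exact_mod_cast hb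
  have hβ : 0 < Real.sqrt b := Real.sqrt_pos.2 hb'
  have hββ : Real.sqrt b * Real.sqrt b = b := Real.mul_self_sqrt hb'.le
  obtain ⟨Jr, hJI, hsq, hc, hp, hT⟩ := exists_complexStructure_comm_of_anticomm D.Eℝ D.I₀ (j.baseChange ℝ)
    D.Eℝ_swap D.Eℝ_I₀ D.I₀_I₀ (D.baseChange_I₀_of_anticomm j hjα)
    (fun x => by rw [baseChange_baseChange_of_comp_self j hjj, hββ])
    (D.Eℝ_baseChange_left j hjE) hβ D.Eℝ_nondegenerate
  let J : D.Cx →ₗ[ℂ] D.Cx :=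
    { toFun := fun x => D.toCx (Jr (D.ofCx x))
      map_add' := fun x y => by
        change D.toCx (Jr (D.ofCx x + D.ofCx y)) = _
        rw [map_add, map_add]
      map_smul' := fun z x => by
        rw [ofCx_smul, map_add, map_smul, map_smul, hJI, RingHom.id_apply, smul_toCx] }
  have hJ : ∀ x, J x = D.toCx (Jr (D.ofCx x)) := fun _ => rfl
  have hrealJ : ∀ a, D.realJ J a = Jr a := fun _ => rfl
  refine ⟨J, (D.isWeilComplexStructure_iff J).2 ⟨fun x => ?_, fun x y => ?_, fun x hx => ?_⟩, fun a => ?_⟩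
  · rw [hJ, hJ, ofCx_toCx, hsq, map_neg, toCx_ofCx]
  · rw [hJ, hJ, ofCx_toCx, ofCx_toCx, hc]
  · rw [hJ, ofCx_toCx]
    exact hp _ fun h => hx (by rw [← D.toCx_ofCx x, h, map_zero])
  · rw [hrealJ, hrealJ, hT]

/-- **`j` is an endomorphism of the Hodge structure of every point of the type-II sub-domain**: if `J ∈ X⁺(D)` commutes
with `j_ℝ`, then `j_ℂ` preserves `V^{1,0}_J = {a + iJa}` (van Geemen 5.7: an operator commuting with the complex
structure acts on the abelian variety up to isogeny; here at the level of the `ℚ`-Hodge structure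
`D.hodgeStructure J`). [cite: vanGeemen1994HodgeAV, 5.7] -/
theorem baseChange_mem_piece_one_zero_of_comm {J : D.Cx →ₗ[ℂ] D.Cx} (hJ : ∀ x, J (J x) = -x)
    (hcomm : ∀ a, j.baseChange ℝ (D.realJ J a) = D.realJ J (j.baseChange ℝ a)) {x : ℂ ⊗[ℚ] V}
    (hx : x ∈ (D.hodgeStructure J hJ).piece 1 0) : j.baseChange ℂ x ∈ (D.hodgeStructure J hJ).piece 1 0 := by
  rw [piece_one_zero_hodgeStructure] at hx ⊢
  exact HodgeStructure.baseChange_mem_cxF1 (D.realJ J) j hcomm hx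

/-- … equivalently `j_ℂ F^p ⊆ F^p` for the whole Hodge filtration of `D.hodgeStructure J`: `j` is a morphism of
`ℚ`-Hodge structures of weight one. [cite: vanGeemen1994HodgeAV, 5.7] -/
theorem map_F_hodgeStructure_le_of_comm {J : D.Cx →ₗ[ℂ] D.Cx} (hJ : ∀ x, J (J x) = -x)
    (hcomm : ∀ a, j.baseChange ℝ (D.realJ J a) = D.realJ J (j.baseChange ℝ a)) (p : ℤ) :
    ((D.hodgeStructure J hJ).F p).map (j.baseChange ℂ) ≤ (D.hodgeStructure J hJ).F p :=
  HodgeStructure.map_F_hodgeStructureOfCx_le (D.realJ J) (D.realJ_realJ J hJ) j hcomm p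

/-- On `(V_ℝ, i)` itself: if `J` commutes with `j_ℝ` and `Jx = i·x`, then `J(jx) = -i·jx` — `j` carries the
`i`-eigenspace `V₊ = ker(J - i)` of `J` into the `(-i)`-eigenspace `V₋ = V₊^⊥` (and back), the condition "`jV₊ = V₋`"
singling out the type-II sub-domain inside van Geemen's `Hₙ = {V₊ : H|_{V₊} > 0}`. [cite: vanGeemen1994HodgeAV, 5.5 and 5.8] -/
theorem apply_typeII_of_apply_eq_I_smul (hjα : ∀ x, j (D.α x) = -(D.α (j x))) {J : D.Cx →ₗ[ℂ] D.Cx}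
    (hcomm : ∀ a, j.baseChange ℝ (D.realJ J a) = D.realJ J (j.baseChange ℝ a)) {x : D.Cx}
    (hx : J x = Complex.I • x) :
    J (D.toCx (j.baseChange ℝ (D.ofCx x))) = -(Complex.I • D.toCx (j.baseChange ℝ (D.ofCx x))) := by
  have h := hcomm (D.ofCx x)
  rw [realJ_apply, realJ_apply, toCx_ofCx, hx] at h
  have h' : J (D.toCx (j.baseChange ℝ (D.ofCx x))) = D.toCx (j.baseChange ℝ (D.ofCx (Complex.I • x))) := by
    rw [h, toCx_ofCx]
  rw [h', D.toCx_baseChange_smul j hjα, Complex.conj_I, neg_smul]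

/-- **Package: the type-II sub-domain carries `j` as a Hodge endomorphism.** For `D`, `j` as above with `b > 0` there
are `J ∈ X⁺(D)` commuting with `j_ℝ` such that `j_ℂ V^{1,0}_J ⊆ V^{1,0}_J` — the shape consumed by clause (5U) of Deligne's
period construction (a fibre `Y_s` and a rational `K`-linear `β : H¹(P; ℚ) ≃ H¹(Y_s; ℚ)` carrying `V^{1,0}_J` into
`H^{1,0}(Y_s)`) followed by Riemann's theorem (`βjβ⁻¹ = k⁻¹ψ^*` for an endomorphism `ψ` of `Y_s`): the Hodge-theoretic
content of "the type-II locus of the Weil family through a datum carrying `D = K ⊕ Kj` is non-empty".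
[cite: vanGeemen1994HodgeAV, 5.5–5.8] [cite: Shimura1963AnalyticFamilies, §4 (Type II)]
[cite: Deligne1982HodgeCycles, proof of Thm. 4.8, p. 47] -/
theorem exists_typeII_weilComplexStructure [FiniteDimensional ℚ V] (hjα : ∀ x, j (D.α x) = -(D.α (j x)))
    (hjj : ∀ x, j (j x) = b • x) (hjE : ∀ x y, D.E (j x) y = D.E x (j y)) (hb : 0 < b) :
    ∃ (J : D.Cx →ₗ[ℂ] D.Cx) (hW : IsWeilComplexStructure D.hForm J),
      (∀ a, j.baseChange ℝ (D.realJ J a) = D.realJ J (j.baseChange ℝ a)) ∧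
        ∀ x ∈ (D.hodgeStructure J hW.sq).piece 1 0, j.baseChange ℂ x ∈ (D.hodgeStructure J hW.sq).piece 1 0 := by
  obtain ⟨J, hW, hcomm⟩ := D.exists_isWeilComplexStructure_comm_typeII j hjα hjj hjE hb
  exact ⟨J, hW, hcomm, fun x hx => D.baseChange_mem_piece_one_zero_of_comm j hW.sq hcomm hx⟩

end WeilDatum

end Literature.AlgebraicGeometry.Motives

end
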